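import Summits.BirchSwinnertonDyer.BirchSwinnertonDyer.Theorems.ResidualThetaTransportAtTwoKatoZetaDefs
import HarnessLib

/-!
# stub-ideation k3 · g26 (technique: decomposition) — the RECOMBINATION SEAM of the (i)-half interior node I1 / EV-C(u)

Crux `ResidualThetaCountLowerPureAtTwo` (stmt-BirchSwinnertonDyer-26074), stub `stub_cmLambdaLower` (= RSL_g, stmt-22608), skeleton
`Lines/bt26_lambda.lean` v7. SKETCH ONLY: no instance / notation / axiom; `sorry` only inside the four registered-shape sub-stubs `stub_*` of §B.
BSD is NOT proved by any of this; 26074 / 22608 / 24105 stay OPEN / HOLD.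

WHAT IS HERE. The one remaining M-node of the KZ_g (i)-half after rev 27.2 — «KatoValuedClass ⟹ scaled column values / MTV» (critic I1; pen
`stub_kzgValueRelation`; k3-g25's socket EV-C(u)) — factors through ONE `Λ_𝒪`-identity for the station-(E) trivialisation `e : Λⁿ ≃+ Λ_𝒪`:

  (REC)  `e (κ x) = C x · e (κ 1)` for every `x ∈ 𝒪`, `κ x := (t₀(c′_i x))_i` the Θ-coordinate vector of `x` (as constant power series),

forced by (E)'s `Λ_𝒪`-linearity of `e ∘ 𝒸` on `Λ_𝒪 z` together with the `𝒪`-equivariance of `𝒸` that (BKρ) transports from the class to the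
Coleman column (`B(x) · 𝒸(y • z) = 2^a · 𝒸(xy • z)`), and (CU) the recombinator `F := e (κ 1)` is a CONSTANT times a UNIT of `Λ_𝒪` (because
`F ∣ C(2^c)`). With (REC) the `t₀`-recombination of the coordinatewise character sums collapses onto the `bO`-recombined Kato value of (VALρ)
(`columnValue_eq_of_coordSum_of_rec`), and with (CU) the value identity takes EXACTLY the `(ν ∈ 𝒪 ∖ 0, w ∈ Λ_𝒪ˣ)` shape of the relay / EV sockets
at the FIXED multiplier `μt` (T81), the `ℚ̄₂`-constant `2^a q` riding on the `μt` side (T82).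

§A (PROVED, generic over `ι : A →+* O`): `apply_eq_sum_map_mul`, `columnValue_eq_of_coordSum_of_rec`, `recombination_of_equivariance` (REC from
equivariance + fullness), `exists_mul_eq_C_of_rec` (`C c₀ = G · F`), `eq_C_pow_mul_unit_of_mul_eq_C_pow` (divisor of a constant prime power is
constant × unit), `frame_of_equivariance` (H-eqv's transported equivariance + Σ_bal's Θ-Schur equivariance on a separating column family ⇒ `B(x) = 2^a·A(x)`:
k1-g28's FRAME(c′) is DERIVED from child A's clauses as they stand — S142 STAND, no 7th conjunct). §B (pins `π : OnePairPins …`): `padicIntToCoeffIntegers_injective`, `exists_eq_sum_map_mul_C` (`Λ_𝒪 = Σ_j Λ·C(bO_j)`, from `hbO`)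
PROVED; `recombination_of_cvecEquivariance` (REC at the pins from the equivariance sub-stub, PROVED from §A); sub-stubs (sorry, registered shape):
`stub_scaledColumnValues_of_katoValuedClass` (TOP: EV-C(2^a q) typed against the landed `KatoValuedClass` — critic Q147's §5 re-enable in the
S148/T82 currency; the other three + the card's σ1 are ITS decomposition), `stub_cvecEquivariance` (H-eqv), `stub_full` (H-full),
`stub_recombinatorShape` (CU). No non-degeneracy sub-stub: the branch `𝒸 z = 0` of the top statement is trivially true (both sides vanish).

References: [Kato2004Asterisque] Thm. 12.5 (1) (pp. 221–222), §14.9 (p. 239), §15.16 (p. 265); [BlochKato1990] (3.10.1), (3.11);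
[Kobayashi2003] Thm. 6.2, (8.23)–(8.26) (pp. 18–23); [Washington1997] §7.1 (Weierstrass preparation), §13.2.
-/

set_option autoImplicit false
set_option linter.dupNamespace false
set_option backward.isDefEq.respectTransparency false

noncomputable section

open scoped Classical NumberField

namespace Summit.BirchSwinnertonDyer.BirchSwinnertonDyer.Cruxes.ResidualThetaCountLowerPureAtTwo.SideaK3G26

open Matrix

/-! ## §A Generic kernel algebra (PROVED) -/

section Generic

variable {A O : Type*} [CommRing A] [CommRing O] {n : ℕ}

/-- A `Λ`-semilinear additive `e : Λⁿ ≃+ Λ_𝒪` is determined by its values `E_i := e(δ_i)`: `e(t) = Σ_i t_i · E_i`. -/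
theorem apply_eq_sum_map_mul (ι : A →+* O) (e : (Fin n → PowerSeries A) ≃+ PowerSeries O)
    (he : ∀ (r : PowerSeries A) (t : Fin n → PowerSeries A), e (r • t) = PowerSeries.map ι r * e t)
    (t : Fin n → PowerSeries A) :
    e t = ∑ i, PowerSeries.map ι (t i) * e (Pi.single i 1) := by
  conv_lhs => rw [← Finset.univ_sum_single t]
  rw [map_sum]
  refine Finset.sum_congr rfl fun i _ => ?_
  rw [← he]
  congr 1
  funext j
  by_cases h : j = i
  · subst h; simp
  · simp [h]

/-- **The junction (XS, the content-free half of the seam).** If the coordinatewise character sums are `P_i = c · Σ_j T_{ij} X_j` (σ1) and the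
`t₀`-recombination of the column coefficients is `Σ_i T_{ij} E_i = b_j · F` ((REC) evaluated), then the column value `Σ_i P_i E_i` is
`c · F · Σ_j b_j X_j` — `c·F` times the `bO`-recombined Kato value that (VALρ) computes. -/
theorem columnValue_eq_of_coordSum_of_rec {R : Type*} [CommRing R] {k : ℕ} (P E : Fin n → R) (T : Fin n → Fin k → R)
    (X b : Fin k → R) (c F : R)
    (hP : ∀ i, P i = c * ∑ j, T i j * X j) (hrec : ∀ j, ∑ i, T i j * E i = b j * F) :
    ∑ i, P i * E i = c * F * ∑ j, b j * X j := by
  have h1 : ∀ i, P i * E i = c * ∑ j, T i j * E i * X j := fun i => by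
    rw [hP i, mul_assoc, Finset.sum_mul]
    congr 1
    exact Finset.sum_congr rfl fun j _ => by ring
  simp_rw [h1, ← Finset.mul_sum]
  rw [mul_assoc]
  congr 1
  rw [Finset.sum_comm, Finset.mul_sum]
  refine Finset.sum_congr rfl fun j _ => ?_
  rw [← Finset.sum_mul, hrec j]
  ring

/-- **(REC) from equivariance + fullness (the load-bearing kernel lemma, S).** `e : Λⁿ ≃+ Λ_𝒪` additive and `Λ`-semilinear (`he`); `V ∈ Λ_𝒪`
with `e (cv y) = C y · V` for the «columns» `cv y` (station (E) on `Λ_𝒪 z`); integer matrices `B x` with `B x · cv y = a · cv (x y)` (the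
equivariance (BKρ) transports to the column) and `B x · κ 1 = a · κ x` on the coordinate vectors; every `t ∈ Λ_𝒪` has a nonzero `Λ`-multiple in
`Λ_𝒪 · V` (fullness: `V ≠ 0`, `Λ_𝒪` finite free over `Λ`); `Λ_𝒪` is the `Λ`-span of the constants. THEN `e (κ x) = C x · e (κ 1)`. -/
theorem recombination_of_equivariance [IsDomain O] (ι : A →+* O) (hι : Function.Injective ι)
    (e : (Fin n → PowerSeries A) ≃+ PowerSeries O)
    (he : ∀ (r : PowerSeries A) (t : Fin n → PowerSeries A), e (r • t) = PowerSeries.map ι r * e t)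
    (V : PowerSeries O) (cv : O → (Fin n → PowerSeries A)) (hcv : ∀ y, e (cv y) = PowerSeries.C y * V)
    (a : A) (ha : a ≠ 0) (B : O → Matrix (Fin n) (Fin n) A)
    (hB : ∀ x y, (B x).map (fun t : A => PowerSeries.C t) *ᵥ cv y = (PowerSeries.C a : PowerSeries A) • cv (x * y))
    (κ : O → Fin n → A) (hκ : ∀ x, B x *ᵥ κ 1 = a • κ x)
    (hfull : ∀ t : PowerSeries O, ∃ r : PowerSeries A, r ≠ 0 ∧ ∃ s : PowerSeries O, PowerSeries.map ι r * t = s * V)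
    (hspan : ∀ s : PowerSeries O, ∃ (k : ℕ) (r : Fin k → PowerSeries A) (y : Fin k → O),
      s = ∑ l, PowerSeries.map ι (r l) * PowerSeries.C (y l)) :
    ∀ x, e (fun i => PowerSeries.C (κ x i)) = PowerSeries.C x * e (fun i => PowerSeries.C (κ 1 i)) := by
  intro x
  have hmapne : ∀ r : PowerSeries A, r ≠ 0 → PowerSeries.map ι r ≠ 0 := by
    intro r hr h0
    apply hr
    ext k
    have hk := congrArg (PowerSeries.coeff k) h0
    rw [PowerSeries.coeff_map, map_zero] at hk
    rw [map_zero]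
    exact hι (by rw [hk, map_zero])
  have hsymm : ∀ (r : PowerSeries A) (t : PowerSeries O), e.symm (PowerSeries.map ι r * t) = r • e.symm t := by
    intro r t
    apply e.injective
    rw [he, e.apply_symm_apply, e.apply_symm_apply]
  -- the defect map `ψ t := e (B̃x · e⁻¹ t) − C(ι a · x) · t`
  let ψ : PowerSeries O →+ PowerSeries O :=
    { toFun := fun t => e ((B x).map (fun t : A => PowerSeries.C t) *ᵥ e.symm t) - PowerSeries.C (ι a * x) * t
      map_zero' := by simp [Matrix.mulVec_zero]
      map_add' := fun t₁ t₂ => by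
        simp only [map_add, Matrix.mulVec_add]
        ring }
  have hψ : ∀ t, ψ t = e ((B x).map (fun t : A => PowerSeries.C t) *ᵥ e.symm t) - PowerSeries.C (ι a * x) * t :=
    fun _ => rfl
  have hψ_smul : ∀ (r : PowerSeries A) (t : PowerSeries O),
      ψ (PowerSeries.map ι r * t) = PowerSeries.map ι r * ψ t := by
    intro r t
    rw [hψ, hψ, hsymm, Matrix.mulVec_smul, he]
    ring
  have hψ_gen : ∀ y : O, ψ (PowerSeries.C y * V) = 0 := by
    intro y
    rw [hψ, ← hcv, e.symm_apply_apply, hB, he, PowerSeries.map_C, sub_eq_zero]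
    simp only [hcv, map_mul]
    ring
  have hψ_mulV : ∀ s : PowerSeries O, ψ (s * V) = 0 := by
    intro s
    obtain ⟨k, r, y, rfl⟩ := hspan s
    rw [Finset.sum_mul, map_sum]
    refine Finset.sum_eq_zero fun l _ => ?_
    rw [mul_assoc, hψ_smul, hψ_gen, mul_zero]
  have hψ_zero : ∀ t, ψ t = 0 := by
    intro t
    obtain ⟨r, hr, s, hs⟩ := hfull t
    have h1 : PowerSeries.map ι r * ψ t = 0 := by rw [← hψ_smul, hs, hψ_mulV]
    exact (mul_eq_zero.mp h1).resolve_left (hmapne r hr)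
  -- evaluate the defect at `t := e (κ 1)`
  have hmv : (B x).map (fun t : A => PowerSeries.C t) *ᵥ (fun i => PowerSeries.C (κ 1 i)) =
      (PowerSeries.C a : PowerSeries A) • (fun i => PowerSeries.C (κ x i)) := by
    funext i
    have h := RingHom.map_mulVec (PowerSeries.C (R := A)) (B x) (κ 1) i
    rw [hκ] at h
    simp only [Pi.smul_apply, smul_eq_mul, map_mul] at h
    rw [Pi.smul_apply, smul_eq_mul]
    exact h.symm
  have hfin := hψ_zero (e (fun i => PowerSeries.C (κ 1 i)))
  rw [hψ, e.symm_apply_apply, hmv, he, PowerSeries.map_C, map_mul, sub_eq_zero] at hfin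
  have hCa : (PowerSeries.C (ι a) : PowerSeries O) ≠ 0 := by
    rw [← PowerSeries.map_C ι a]
    exact hmapne _ (by
      intro h0
      apply ha
      have := congrArg (PowerSeries.coeff 0) h0
      rwa [PowerSeries.coeff_zero_C, map_zero] at this)
  exact mul_left_cancel₀ hCa (by rw [hfin, mul_assoc])

/-- **The column coefficients are `K`-proportional: `C c₀ · E_i = C y_i · F`** (`E_i := e(δ_i)`, `κ (y i) = c₀ δ_i`), i.e.
`E_i = β_i · F` with `β_i = y_i / c₀ ∈ K` the `t₀`-dual family of `c′` — the content of (REC) read coefficientwise. -/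
theorem C_mul_apply_single_eq_of_rec (ι : A →+* O) (e : (Fin n → PowerSeries A) ≃+ PowerSeries O)
    (he : ∀ (r : PowerSeries A) (t : Fin n → PowerSeries A), e (r • t) = PowerSeries.map ι r * e t)
    (κ : O → Fin n → A) (F : PowerSeries O)
    (hrec : ∀ x, e (fun i => PowerSeries.C (κ x i)) = PowerSeries.C x * F)
    (c₀ : A) (y : Fin n → O) (hy : ∀ i, κ (y i) = Pi.single i c₀) (i : Fin n) :
    PowerSeries.C (ι c₀) * e (Pi.single i 1) = PowerSeries.C (y i) * F := by
  have h1 : (PowerSeries.C c₀ : PowerSeries A) • (Pi.single i (1 : PowerSeries A)) = fun k => PowerSeries.C (κ (y i) k) := by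
    funext k
    rw [hy i]
    by_cases hk : k = i
    · subst hk; simp
    · simp [hk]
  rw [← PowerSeries.map_C ι c₀, ← he, h1, hrec]

/-- **`C c₀ = G · F` from (REC) and the fullness of the coordinate lattice** (`κ (y i) = c₀ δ_i`): the recombinator divides a constant. -/
theorem exists_mul_eq_C_of_rec (ι : A →+* O) (e : (Fin n → PowerSeries A) ≃+ PowerSeries O)
    (he : ∀ (r : PowerSeries A) (t : Fin n → PowerSeries A), e (r • t) = PowerSeries.map ι r * e t)
    (κ : O → Fin n → A) (F : PowerSeries O)
    (hrec : ∀ x, e (fun i => PowerSeries.C (κ x i)) = PowerSeries.C x * F)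
    (c₀ : A) (y : Fin n → O) (hy : ∀ i, κ (y i) = Pi.single i c₀) :
    ∃ G : PowerSeries O, PowerSeries.C (ι c₀) = G * F := by
  have hE : ∀ i, PowerSeries.C (ι c₀) * e (Pi.single i 1) = PowerSeries.C (y i) * F :=
    C_mul_apply_single_eq_of_rec ι e he κ F hrec c₀ y hy
  have h1 : (1 : PowerSeries O) = ∑ i, PowerSeries.map ι (e.symm 1 i) * e (Pi.single i 1) := by
    have := apply_eq_sum_map_mul ι e he (e.symm 1)
    rwa [e.apply_symm_apply] at this
  refine ⟨∑ i, PowerSeries.map ι (e.symm 1 i) * PowerSeries.C (y i), ?_⟩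
  calc PowerSeries.C (ι c₀) = PowerSeries.C (ι c₀) * 1 := (mul_one _).symm
    _ = PowerSeries.C (ι c₀) * ∑ i, PowerSeries.map ι (e.symm 1 i) * e (Pi.single i 1) := by rw [← h1]
    _ = ∑ i, PowerSeries.map ι (e.symm 1 i) * (PowerSeries.C (ι c₀) * e (Pi.single i 1)) := by
        rw [Finset.mul_sum]
        exact Finset.sum_congr rfl fun i _ => by ring
    _ = ∑ i, PowerSeries.map ι (e.symm 1 i) * (PowerSeries.C (y i) * F) := by simp_rw [hE]
    _ = (∑ i, PowerSeries.map ι (e.symm 1 i) * PowerSeries.C (y i)) * F := by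
        rw [Finset.sum_mul]
        exact Finset.sum_congr rfl fun i _ => by ring

/-- **(CU) kernel: a divisor of a constant prime power `C ϖ^N` in `O⟦T⟧` is `C ϖ^r ×` a unit** (given `C ϖ` prime in `O⟦T⟧`; for the habitat
`O = 𝒪_K` a DVR with uniformiser `ϖ`, `O⟦T⟧/(ϖ) = k⟦T⟧` is a domain). Weierstrass preparation is not needed. -/
theorem eq_C_pow_mul_unit_of_mul_eq_C_pow [IsDomain O] {ϖ : O} (hϖ : Prime (PowerSeries.C ϖ : PowerSeries O)) :
    ∀ (N : ℕ) (F G : PowerSeries O), F * G = PowerSeries.C (ϖ ^ N) →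
      ∃ (r : ℕ) (w : PowerSeries O), IsUnit w ∧ F = PowerSeries.C (ϖ ^ r) * w := by
  intro N
  induction N with
  | zero =>
    intro F G h
    rw [pow_zero, map_one] at h
    exact ⟨0, F, IsUnit.of_mul_eq_one G h, by rw [pow_zero, map_one, one_mul]⟩
  | succ N ih =>
    intro F G h
    have hne : (PowerSeries.C ϖ : PowerSeries O) ≠ 0 := hϖ.ne_zero
    have hdvd : (PowerSeries.C ϖ : PowerSeries O) ∣ F * G :=
      ⟨PowerSeries.C (ϖ ^ N), by rw [h, pow_succ, map_mul, mul_comm]⟩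
    rcases hϖ.dvd_or_dvd hdvd with ⟨F', rfl⟩ | ⟨G', rfl⟩
    · have h' : F' * G = PowerSeries.C (ϖ ^ N) := by
        apply mul_left_cancel₀ hne
        rw [← mul_assoc, h, pow_succ, map_mul, mul_comm]
      obtain ⟨r, w, hw, hF'⟩ := ih F' G h'
      exact ⟨r + 1, w, hw, by rw [hF', ← mul_assoc, ← map_mul, ← pow_succ']⟩
    · have h' : F * G' = PowerSeries.C (ϖ ^ N) := by
        apply mul_left_cancel₀ hne
        rw [mul_left_comm, h, pow_succ, map_mul, mul_comm]
      exact ih F G' h'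

/-- **FRAME from equivariance (reconciliation with k1-g28's FRAME LEDGER; kernel).** If the column family `cv y := 𝒸(C y • z)` satisfies BOTH the
transported equivariance `B(x) · cv y = a · cv (x y)` (H-eqv, from (BKρ) + H1) AND the Σ_bal equivariance `cv (x y) = A(x) · cv y` (Θ's Schur matrices,
landed `cvec_C_smul` lineage), and the family separates matrices (`hsep`: it spans after extension of scalars — automatic from `𝒸 z ≠ 0` and `f = n`, the
`K((T))`-line argument of the card), then `B(x) = a · A(x)` for every `x`: the `t₀`-coordinate matrices of child A's `c′` ARE Θ's Schur matrices up to
the index scalar `a = 2^a₀` — i.e. k1-g28's FRAME(c′) is DERIVED, not assumed. -/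
theorem frame_of_equivariance (cv : O → Fin n → PowerSeries A) (a : A) (B Am : O → Matrix (Fin n) (Fin n) A)
    (hB : ∀ x y : O, (B x).map (fun t : A => PowerSeries.C t) *ᵥ cv y = (PowerSeries.C a : PowerSeries A) • cv (x * y))
    (hA : ∀ x y : O, cv (x * y) = (Am x).map (fun t : A => PowerSeries.C t) *ᵥ cv y)
    (hsep : ∀ M : Matrix (Fin n) (Fin n) A, (∀ y : O, M.map (fun t : A => PowerSeries.C t) *ᵥ cv y = 0) → M = 0) :
    ∀ x : O, B x = a • Am x := by
  intro x
  apply eq_of_sub_eq_zero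
  apply hsep
  intro y
  have hmap : (B x - a • Am x).map (fun t : A => PowerSeries.C t) =
      (B x).map (fun t : A => PowerSeries.C t) - (PowerSeries.C a : PowerSeries A) • (Am x).map (fun t : A => PowerSeries.C t) := by
    ext i j
    simp [Matrix.map_apply, Matrix.sub_apply, Matrix.smul_apply, smul_eq_mul]
  rw [hmap, Matrix.sub_mulVec, Matrix.smul_mulVec, hB, hA, sub_self]

end Generic

/-! ## §B At the pins `π : OnePairPins …` (two PROVED helpers, the PROVED σ2-from-parts, four sub-stubs of registered shape)

The binders are those of `Theorems.ResidualThetaTransportAtTwoKatoZetaDefs` (child A / child B of KZ_g) verbatim; `S` is a general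
coefficient set (the habitat is `S = Set.range ι`, where `𝒪 = 𝒪_K` is a complete DVR, `K = ℚ₂(ι F_g)` finite). -/

section Pins

open Summit.BirchSwinnertonDyer.BirchSwinnertonDyer.Theorems.OnePair
open Literature.NumberTheory.EllipticCurves Literature.NumberTheory.EllipticCurves.GreenbergSelmer
open Literature.NumberTheory.GaloisRepresentations NumberField IsDedekindDomain Field
open GreenbergVatsal2000 Kobayashi2003 Rat.HeightOneSpectrum PowerSeries
open Literature.NumberTheory.EllipticCurves.FormalGroupChart
open Summit.BirchSwinnertonDyer.Rank1Residual.Additive Summit.BirchSwinnertonDyer.Rank1Residual.Additive.PadicCyclotomicTower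
  Summit.BirchSwinnertonDyer.Rank1Residual.Additive.BallEval
open Summit.BirchSwinnertonDyer.BirchSwinnertonDyer.Theorems.SignedKatoOffTwo
  Summit.BirchSwinnertonDyer.BirchSwinnertonDyer.Theorems.SignedKatoOffTwo.LocalTwo

variable {S : Set (PadicAlgCl 2)} {W : WeierstrassCurve ℚ} [W.IsElliptic] {κ : ZpExtension ℚ 2} {γ : absoluteGaloisGroup ℚ}
  {S₀ : Finset (HeightOneSpectrum (𝓞 ℚ))} {n : ℕ} {ρ : FramedGaloisRep ℚ ↥(padicCoeffIntegers S) 2}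
  {Θ : ∀ v : HeightOneSpectrum (𝓞 ℚ), ((2 : ℕ) : 𝓞 ℚ) ∈ v.asIdeal → (Cofree ρ ↥(padicCoeffField S) ≃+ (Fin n → ↥(W.geomPrimaryTorsion 2)))}
  {hΘ : ∀ v hv (δ : absoluteGaloisGroup (v.adicCompletion ℚ)) m i,
    Θ v hv (resGalOfEmb (closureEmb (K := ℚ) (v.adicCompletion ℚ)) δ • m) i = resGalOfEmb (closureEmb (K := ℚ) (v.adicCompletion ℚ)) δ • Θ v hv m i}
  {I : Kato2004.IwasawaH1DataCoeff (FramedGaloisRep.toGaloisRep ρ) 2 κ γ}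
  {Sg : AddSubgroup (subgroupH1 κ.kerSubgroup (Cofree ρ ↥(padicCoeffField S)))} [Module ↥(padicCoeffIntegers S) ↥Sg]
  (π : OnePairPins S W κ γ S₀ n ρ Θ hΘ I Sg)

omit [W.IsElliptic] in
/-- `ℤ₂ ↪ 𝒪` is injective (`𝒪 ⊂ ℚ̄₂` a subring of a characteristic-zero field). [folklore] -/
theorem padicIntToCoeffIntegers_injective : Function.Injective (padicIntToCoeffIntegers S) := by
  intro a b h
  have h' := congrArg (fun x : ↥(padicCoeffIntegers S) => (x : PadicAlgCl 2)) h
  simp only [coe_padicIntToCoeffIntegers] at h'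
  exact Subtype.ext ((algebraMap ℚ_[2] (PadicAlgCl 2)).injective h')

/-- **H-span (PROVED from the pin `hbO`)**: every `s ∈ Λ_𝒪` is `Σ_j r_j · C(bO_j)` with `r_j ∈ Λ = ℤ₂⟦T⟧` (coefficientwise
`a = Σ_j t₀(a · bO′_j) bO_j`). [cite: Kato2004Asterisque, §14.9 (p. 239)] -/
theorem exists_eq_sum_map_mul_C (s : IwasawaAlgebraO S) :
    ∃ r : Fin π.nb → PowerSeries ℤ_[2], s = ∑ j, PowerSeries.map (padicIntToCoeffIntegers S) (r j) * PowerSeries.C (π.bO j) := by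
  refine ⟨fun j => PowerSeries.mk fun k => π.t₀ (PowerSeries.coeff k s * π.bO' j), PowerSeries.ext fun k => ?_⟩
  rw [map_sum]
  exact (π.hbO _).trans (Finset.sum_congr rfl fun j _ => by
    rw [PowerSeries.coeff_mul_C, PowerSeries.coeff_map, PowerSeries.coeff_mk])

/-- **Sub-stub H-full (S; kernel).** `Λ_𝒪` is finite free over `Λ` (basis `C(bO_j)`), so for `V ≠ 0` the norm `r := N_{Λ_𝒪/Λ}(V) =
det(mult_V) ∈ Λ ∖ 0` lies in `V · Λ_𝒪` (adjugate), whence `r · t ∈ Λ_𝒪 · V` for every `t`. Finite-dimensionality of `K/ℚ₂` is the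
pins' habitat (`π.B : ℤ₂^f ≃ 𝒪`). [cite: Washington1997, §13.2] -/
theorem stub_full [FiniteDimensional ℚ_[2] ↥(padicCoeffField S)] (V : IwasawaAlgebraO S) (hV : V ≠ 0) (t : IwasawaAlgebraO S) :
    ∃ r : PowerSeries ℤ_[2], r ≠ 0 ∧ ∃ s : IwasawaAlgebraO S,
      PowerSeries.map (padicIntToCoeffIntegers S) r * t = s * V := by
  sorry

/-- **Sub-stub H-eqv (S given H1; the transported equivariance).** From (ND) + `f = n` the coordinate lattice `κ(𝒪) ⊂ ℤ₂ⁿ` has finite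
index `∣ 2^a`, so `x ↦` «multiplication by `x` read in coordinates, times `2^a`» is an INTEGER matrix `B(x)` with `B(x) κ(y) = 2^a κ(xy)`;
(BKρ) says the functional `ℓ_i(C y • z)` is `Σ_j t₀(c′_i y bO_j) · G_j` on formal layer points, hence `Σ_{i′} B(x)_{ii′} ℓ_{i′}(C y • z)`
and `2^a ℓ_i(C (xy) • z)` AGREE on all formal layer points — in particular on the (formal, displayed) Honda orbit — and the column's
uniqueness pin (6) (along the displayed datum, via the landed torsor `ColemanPlusTorsor.OnePairPins.exists_unit_mul_col_of_pin` + H1) or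
«`3 · P` is formal» (`#Ẽ(𝔽₂) = 3`) makes their `col`-images equal; `col` is `ℤ₂`-linear. [cite: Kato2004Asterisque, Thm. 12.5 (1) (p. 221)]
[cite: BlochKato1990, (3.10.1)] [cite: Kobayashi2003, Thm. 6.2, (8.23)] -/
theorem stub_cvecEquivariance [W.IsGloballyMinimal] {M : ℕ} [NeZero M] (g : CuspForm (CongruenceSubgroup.Gamma0 M) 2)
    (ι : ModularForms.coeffField g →+* PadicAlgCl 2) (Ω : ℂ) (F : π.KatoFrame) (z : I.H)
    (c' : Fin n → ↥(padicCoeffIntegers S)) (w : ℕ → Fin π.nb → PadicAlgCl 2) (q : PadicAlgCl 2) (μt : IwasawaAlgebraO S)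
    (hK : π.KatoValuedClass g ι Ω F.Φ F.τ z c' w q μt) (hfn : π.f = n) :
    ∃ (a : ℕ) (B : ↥(padicCoeffIntegers S) → Matrix (Fin n) (Fin n) ℤ_[2]),
      (∀ x : ↥(padicCoeffIntegers S), B x *ᵥ (fun i => π.t₀ (c' i * 1)) = ((2 : ℤ_[2]) ^ a) • (fun i => π.t₀ (c' i * x))) ∧
      ∀ x y : ↥(padicCoeffIntegers S),
        (B x).map (fun t : ℤ_[2] => PowerSeries.C t) *ᵥ π.cvec ((PowerSeries.C y : IwasawaAlgebraO S) • z) =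
          (PowerSeries.C ((2 : ℤ_[2]) ^ a) : PowerSeries ℤ_[2]) • π.cvec ((PowerSeries.C (x * y) : IwasawaAlgebraO S) • z) := by
  sorry

/-- **σ2 (REC) at the pins, PROVED from H-eqv's output + H-full + station (E)'s `hlin`** (an instance of `recombination_of_equivariance`
with `A = ℤ₂`, `O = 𝒪`, `cv y = 𝒸(C y • z)`, `V = e(𝒸 z)`, H-span from `hbO`): `e(κ x) = C x · e(κ 1)` for all `x ∈ 𝒪`.
[cite: Kato2004Asterisque, Thm. 12.5 (1) (pp. 221–222), §14.9 (p. 239)] -/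
theorem recombination_of_cvecEquivariance (z : I.H) (c' : Fin n → ↥(padicCoeffIntegers S))
    (e : (Fin n → PowerSeries ℤ_[2]) ≃+ IwasawaAlgebraO S)
    (he : ∀ (r : PowerSeries ℤ_[2]) (t : Fin n → PowerSeries ℤ_[2]), e (r • t) = PowerSeries.map (padicIntToCoeffIntegers S) r * e t)
    (hlin : ∀ (s : IwasawaAlgebraO S) (x : I.H), x ∈ Submodule.span (IwasawaAlgebraO S) ({z} : Set I.H) →
      e (π.cvec (s • x)) = s * e (π.cvec x))
    (a : ℕ) (B : ↥(padicCoeffIntegers S) → Matrix (Fin n) (Fin n) ℤ_[2])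
    (hκ : ∀ x : ↥(padicCoeffIntegers S), B x *ᵥ (fun i => π.t₀ (c' i * 1)) = ((2 : ℤ_[2]) ^ a) • (fun i => π.t₀ (c' i * x)))
    (hB : ∀ x y : ↥(padicCoeffIntegers S),
      (B x).map (fun t : ℤ_[2] => PowerSeries.C t) *ᵥ π.cvec ((PowerSeries.C y : IwasawaAlgebraO S) • z) =
        (PowerSeries.C ((2 : ℤ_[2]) ^ a) : PowerSeries ℤ_[2]) • π.cvec ((PowerSeries.C (x * y) : IwasawaAlgebraO S) • z))
    (hfull : ∀ t : IwasawaAlgebraO S, ∃ r : PowerSeries ℤ_[2], r ≠ 0 ∧ ∃ s : IwasawaAlgebraO S,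
      PowerSeries.map (padicIntToCoeffIntegers S) r * t = s * e (π.cvec z)) :
    ∀ x : ↥(padicCoeffIntegers S), e (fun i => PowerSeries.C (π.t₀ (c' i * x))) =
      PowerSeries.C x * e (fun i => PowerSeries.C (π.t₀ (c' i * 1))) := by
  have hcv : ∀ y : ↥(padicCoeffIntegers S),
      e (π.cvec ((PowerSeries.C y : IwasawaAlgebraO S) • z)) = PowerSeries.C y * e (π.cvec z) :=
    fun y => hlin (PowerSeries.C y) z (Submodule.mem_span_singleton_self z)
  have hspan : ∀ s : IwasawaAlgebraO S, ∃ (k : ℕ) (r : Fin k → PowerSeries ℤ_[2]) (y : Fin k → ↥(padicCoeffIntegers S)),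
      s = ∑ l, PowerSeries.map (padicIntToCoeffIntegers S) (r l) * PowerSeries.C (y l) := fun s => by
    obtain ⟨r, hr⟩ := exists_eq_sum_map_mul_C π s
    exact ⟨π.nb, r, π.bO, hr⟩
  exact recombination_of_equivariance (padicIntToCoeffIntegers S) padicIntToCoeffIntegers_injective e he (e (π.cvec z))
    (fun y => π.cvec ((PowerSeries.C y : IwasawaAlgebraO S) • z)) hcv ((2 : ℤ_[2]) ^ a) (pow_ne_zero a two_ne_zero) B hB
    (fun x i => π.t₀ (c' i * x)) hκ hfull hspan

/-- **Sub-stub (CU) (S; kernel).** The recombinator `F := e(κ 1)` is a nonzero CONSTANT times a UNIT of `Λ_𝒪`: (ND) + `f = n` give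
`y_i ∈ 𝒪` with `κ(y_i) = 2^c δ_i`, so `C(2^c) = G · F` (`exists_mul_eq_C_of_rec`); in `𝒪_K⟦T⟧` (`𝒪_K` a DVR, `2 = ϖ^e ×` unit,
`C ϖ` prime) a divisor of `C ϖ^{ec}` is `C ϖ^r ×` unit (`eq_C_pow_mul_unit_of_mul_eq_C_pow`). So `λ_𝒪(Λ_𝒪 / F) = 0`.
[cite: Washington1997, §7.1] -/
theorem stub_recombinatorShape (c' : Fin n → ↥(padicCoeffIntegers S)) (hc : π.CoordNondeg c') (hfn : π.f = n)
    (e : (Fin n → PowerSeries ℤ_[2]) ≃+ IwasawaAlgebraO S)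
    (he : ∀ (r : PowerSeries ℤ_[2]) (t : Fin n → PowerSeries ℤ_[2]), e (r • t) = PowerSeries.map (padicIntToCoeffIntegers S) r * e t)
    (F : IwasawaAlgebraO S)
    (hrec : ∀ x : ↥(padicCoeffIntegers S), e (fun i => PowerSeries.C (π.t₀ (c' i * x))) = PowerSeries.C x * F) :
    ∃ (f₀ : ↥(padicCoeffIntegers S)) (w₀ : IwasawaAlgebraO S), f₀ ≠ 0 ∧ IsUnit w₀ ∧ F = PowerSeries.C f₀ * w₀ := by
  sorry

/-- **Top sub-stub EV-C(2^a q): the value-form print port, typed against child A's LANDED `KatoValuedClass`** (critic Q147: k3-g25 §5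
re-enabled now that `…KatoZetaDefs` (p714847) builds — in the S148 (iii) / T82(b) currency: the `ℚ̄₂`-constant `2^a · q` EXPLICIT on the
`μt` side, `ν ∈ 𝒪 ∖ 0`, `w₁ ∈ Λ_𝒪ˣ` (T81/T86: `IsUnit`, never `≠ 0`), datum-free column form (S143: no `∀`-datum binder), EVEN levels
`2m` / characters of conductor `2^{2m+2}` (T85: VALρ's index `m′ = 2m`, BKρ's layer `2m`)). For `S = Set.range ι` the conclusion is VERBATIM
the `hEVC` input of k3-g25's PROVED socket `hERL_of_scaledColumnValues_fixedMultiplier` (Sketch_sidea_k3_g25.lean l.838) with `S′ := S ∪ {q}`,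
`u := 2^a q ∈ 𝒪_{S′}` (`φ(u) = algebraMap (2^a q)`), whose output is station (R) at the FIXED `D := μt`. The decomposition of THIS statement
is the card: σ1 (coordinatewise character sums along the displayed formal datum, TP2 port) + H-eqv + H-full ⟹ (REC)
(`recombination_of_cvecEquivariance`, PROVED) + (CU) + the junction `columnValue_eq_of_coordSum_of_rec` (PROVED) + H-MTev (LANDED
`eval₂_map_mazurTateElementK_eq_sum`) + H1 (LANDED `colemanPlus_coeff_two_of_datum`) + the torsor (LANDED). The degenerate branch `𝒸 z = 0`
holds trivially (both sides vanish by σ1 + (VALρ)), so NO non-degeneracy sub-stub is needed. NOT proved here; BSD is not proved by this.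
[cite: Kato2004Asterisque, Thm. 12.5 (1) (pp. 221–222), §15.16 (p. 265)] [cite: Kobayashi2003, Thm. 6.2, Prop. 8.25, Lem. 8.26]
[cite: Pollack2003, Prop. 6.9] -/
theorem stub_scaledColumnValues_of_katoValuedClass [W.IsGloballyMinimal] [FiniteDimensional ℚ_[2] ↥(padicCoeffField S)]
    {M : ℕ} [NeZero M] (g : CuspForm (CongruenceSubgroup.Gamma0 M) 2)
    (ι : ModularForms.coeffField g →+* PadicAlgCl 2) (Ω : ℂ) (F : π.KatoFrame) (z : I.H)
    (c' : Fin n → ↥(padicCoeffIntegers S)) (w : ℕ → Fin π.nb → PadicAlgCl 2) (q : PadicAlgCl 2) (μt : IwasawaAlgebraO S)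
    (hK : π.KatoValuedClass g ι Ω F.Φ F.τ z c' w q μt) (hfn : π.f = n)
    (e : (Fin n → PowerSeries ℤ_[2]) ≃+ IwasawaAlgebraO S)
    (he : ∀ (r : PowerSeries ℤ_[2]) (t : Fin n → PowerSeries ℤ_[2]), e (r • t) = PowerSeries.map (padicIntToCoeffIntegers S) r * e t)
    (hlin : ∀ (s : IwasawaAlgebraO S) (x : I.H), x ∈ Submodule.span (IwasawaAlgebraO S) ({z} : Set I.H) →
      e (π.cvec (s • x)) = s * e (π.cvec x)) :
    ∃ (a : ℕ) (ν : ↥(padicCoeffIntegers S)) (w₁ : IwasawaAlgebraO S), ν ≠ 0 ∧ IsUnit w₁ ∧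
      ∃ m₀ : ℕ, ∀ m : ℕ, m₀ ≤ m → ∀ ζ : ℂ_[2], IsPrimitiveRoot ζ (2 ^ (2 * m)) →
        algebraMap (PadicAlgCl 2) ℂ_[2] ((2 : PadicAlgCl 2) ^ a * q) *
            (∑' k, ((algebraMap (PadicAlgCl 2) ℂ_[2]).comp (padicCoeffIntegers S).subtype) (PowerSeries.coeff k μt) * (ζ - 1) ^ k) *
          ((mazurTateElementK g Ω 2 (2 * m)).map ι).eval₂ (algebraMap (PadicAlgCl 2) ℂ_[2]) (ζ - 1) =
        -(((-1 : Polynomial ℤ) ^ m * cyclotomicOmegaMinus 2 (2 * m)).eval₂ (Int.castRingHom ℂ_[2]) (ζ - 1)) *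
          ∑' k, ((algebraMap (PadicAlgCl 2) ℂ_[2]).comp (padicCoeffIntegers S).subtype)
            (PowerSeries.coeff k (PowerSeries.C ν * w₁ * e (π.cvec z))) * (ζ - 1) ^ k := by
  sorry

end Pins

end Summit.BirchSwinnertonDyer.BirchSwinnertonDyer.Cruxes.ResidualThetaCountLowerPureAtTwo.SideaK3G26

end
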